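import Summits.CriticalPhenomena.PercolationContinuityZ3.Theorems.PercNearOneGluingNoHeavyLowerTailSahiThreeCopyLiterals

/-!
# `NoHeavyLowerTail` (crux stmt-CriticalPhenomena-4575), Sahi programme: **3C-SAHI IS STABLE UNDER OR-ING WITH OR-EVENTS AND AND-ING WITH
# CYLINDERS ON FRESH COORDINATES** — iteration of the literal steps of `…SahiThreeCopyLiterals`, and the resulting new settled classes

Support file (Sahi cell, seat `prim-sahi-p1`, generation 54; `--supports stmt-CriticalPhenomena-4575`); companion of `…SahiThreeCopyLiterals`
(one-literal steps `tc_orAdj_cons_nonneg`, `tc_andAdj_cons_nonneg`).  Pure proofs plus two recursive definitions (`orAdjoin`, `andAdjoin`); no `sorry`,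
standard axioms.

* `orAdjoin m S f = f ∨ OR_S` (adjoin `m` fresh front coordinates, OR the selected ones), `andAdjoin m S f = f · Π_{i∈S} x_i`.
* ★★ `tc_orAdjoin_nonneg` / `tc_andAdjoin_nonneg`: if `f, g, h : {0,1}^d → [0,1]` are monotone with `c_b(f,g,h) ≥ 0` at EVERY profile, then
  `c_b(f ∨ OR_S, g ∨ OR_T, h ∨ OR_U) ≥ 0` and `c_b(f ∧ AND_S, g ∧ AND_T, h ∧ AND_U) ≥ 0` at every profile of `{0,1}^{d+m}`, for all `S, T, U ⊆ [m]`
  (induction on `m` over the one-literal steps).  So the class of triples satisfying the census conjecture 3C-SAHI (CENSUS §175 W197) at all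
  profiles is closed under these operations — a "caterpillar read-once" closure.
* NEW SETTLED CLASSES (coefficientwise, every profile, every dimension): `tc_orAdjoin_principal_nonneg` — `(1_{↑m} ∨ OR_S, 1_B ∨ OR_T, 1_C ∨ OR_U)` for a
  principal up-set and two ARBITRARY up-sets `B, C` (from `…Cylinder`); `tc_orAdjoin_nested_nonneg` — `(1_A ∨ OR_S, 1_B ∨ OR_T, 1_C ∨ OR_U)` with
  `B ⊆ C` (from `…Nested`); `tc_andAdjoin_orInd_nonneg` — three OR-events each AND-ed with a cylinder on fresh coordinates (from `…OrEvents`);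
  law level `sahiE_three_coin_orAdjoin_principal_nonneg` (every product measure).
[this work; conjecture: CENSUS §175 W197 (prim-sahi-census gen 54)]
-/

namespace Summit.CriticalPhenomena.PercolationContinuityZ3.Theorems.SahiThreeCopy

open Finset Function Literature.Combinatorics.Sahi2008
open scoped BigOperators

noncomputable section

variable {d : ℕ}

/-! ### §5 Iteration: adjoining OR-events / cylinders on `m` fresh coordinates -/

/-- Adjoin `m` fresh coordinates (in front) as OR-literals selected by `S : Fin m → Bool`:
`orAdjoin m S f (x) = 1` if `x_i = 1` for some selected fresh `i < m`, else `f(x_m,…,x_{m+d−1})` — i.e. `f ∨ OR_S`. [this work] -/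
def orAdjoin : (m : ℕ) → (Fin m → Bool) → (Pt d → ℝ) → Pt (d + m) → ℝ
  | 0, _, f => f
  | m + 1, S, f => orAdj (S 0) (orAdjoin m (Fin.tail S) f)

/-- Adjoin `m` fresh coordinates as AND-literals selected by `S`: `andAdjoin m S f = f · Π_{i selected} x_i` — i.e. `f ∧ AND_S`. [this work] -/
def andAdjoin : (m : ℕ) → (Fin m → Bool) → (Pt d → ℝ) → Pt (d + m) → ℝ
  | 0, _, f => f
  | m + 1, S, f => andAdj (S 0) (andAdjoin m (Fin.tail S) f)

/-- `orAdjoin` preserves `0 ≤ · ≤ 1` and monotonicity. [this work] -/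
theorem orAdjoin_props : ∀ (m : ℕ) (S : Fin m → Bool) {f : Pt d → ℝ}, (∀ x, 0 ≤ f x) → (∀ x, f x ≤ 1) → Monotone f →
    (∀ x, 0 ≤ orAdjoin m S f x) ∧ (∀ x, orAdjoin m S f x ≤ 1) ∧ Monotone (orAdjoin m S f)
  | 0, _, _, h0, h1, hm => ⟨h0, h1, hm⟩
  | m + 1, S, _, h0, h1, hm => by
    obtain ⟨i0, i1, im⟩ := orAdjoin_props m (Fin.tail S) h0 h1 hm
    exact ⟨orAdj_nonneg _ i0, orAdj_le_one _ i1, orAdj_monotone _ i1 im⟩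

/-- `andAdjoin` preserves `0 ≤ · ≤ 1` and monotonicity. [this work] -/
theorem andAdjoin_props : ∀ (m : ℕ) (S : Fin m → Bool) {f : Pt d → ℝ}, (∀ x, 0 ≤ f x) → (∀ x, f x ≤ 1) → Monotone f →
    (∀ x, 0 ≤ andAdjoin m S f x) ∧ (∀ x, andAdjoin m S f x ≤ 1) ∧ Monotone (andAdjoin m S f)
  | 0, _, _, h0, h1, hm => ⟨h0, h1, hm⟩
  | m + 1, S, _, h0, h1, hm => by
    obtain ⟨i0, i1, im⟩ := andAdjoin_props m (Fin.tail S) h0 h1 hm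
    exact ⟨andAdj_nonneg _ i0, andAdj_le_one _ i1, andAdj_monotone _ i0 im⟩

/-- ★★ **3C-SAHI IS STABLE UNDER OR-ING WITH OR-EVENTS ON FRESH COORDINATES**: if `f, g, h : {0,1}^d → [0,1]` are monotone and
`c_b(f,g,h) ≥ 0` for EVERY profile `b`, then `c_b(f ∨ OR_S, g ∨ OR_T, h ∨ OR_U) ≥ 0` for every profile of `{0,1}^{d+m}` and all
`S, T, U ⊆ [m]`. [this work] -/
theorem tc_orAdjoin_nonneg : ∀ (m : ℕ) (S T U : Fin m → Bool) {f g h : Pt d → ℝ}, (∀ x, 0 ≤ f x) → (∀ x, f x ≤ 1) → Monotone f →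
    (∀ x, 0 ≤ g x) → (∀ x, g x ≤ 1) → Monotone g → (∀ x, 0 ≤ h x) → (∀ x, h x ≤ 1) → Monotone h →
    (∀ b : Fin d → ℕ, 0 ≤ tc b f g h) → ∀ b : Fin (d + m) → ℕ, 0 ≤ tc b (orAdjoin m S f) (orAdjoin m T g) (orAdjoin m U h)
  | 0, _, _, _, _, _, _, _, _, _, _, _, _, _, _, _, htc, b => htc b
  | m + 1, S, T, U, _, _, _, hf0, hf1, hfm, hg0, hg1, hgm, hh0, hh1, hhm, htc, b => by
    obtain ⟨f0, f1, fm⟩ := orAdjoin_props m (Fin.tail S) hf0 hf1 hfm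
    obtain ⟨g0, g1, gm⟩ := orAdjoin_props m (Fin.tail T) hg0 hg1 hgm
    obtain ⟨h0', h1', hm'⟩ := orAdjoin_props m (Fin.tail U) hh0 hh1 hhm
    have IH := tc_orAdjoin_nonneg m (Fin.tail S) (Fin.tail T) (Fin.tail U) hf0 hf1 hfm hg0 hg1 hgm hh0 hh1 hhm htc (Fin.tail b)
    have hb : b = Fin.cons (b 0) (Fin.tail b) := (Fin.cons_self_tail b).symm
    rw [hb]
    exact tc_orAdj_cons_nonneg (b 0) (Fin.tail b) (S 0) (T 0) (U 0) f0 f1 fm g0 g1 gm h0' h1' hm' IH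

/-- ★ **3C-SAHI IS STABLE UNDER AND-ING WITH CYLINDERS ON FRESH COORDINATES**: same with `f ∧ AND_S = f·Π_{i∈S} x_i`. [this work] -/
theorem tc_andAdjoin_nonneg : ∀ (m : ℕ) (S T U : Fin m → Bool) {f g h : Pt d → ℝ}, (∀ x, 0 ≤ f x) → (∀ x, f x ≤ 1) → Monotone f →
    (∀ x, 0 ≤ g x) → (∀ x, g x ≤ 1) → Monotone g → (∀ x, 0 ≤ h x) → (∀ x, h x ≤ 1) → Monotone h →
    (∀ b : Fin d → ℕ, 0 ≤ tc b f g h) → ∀ b : Fin (d + m) → ℕ, 0 ≤ tc b (andAdjoin m S f) (andAdjoin m T g) (andAdjoin m U h)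
  | 0, _, _, _, _, _, _, _, _, _, _, _, _, _, _, _, htc, b => htc b
  | m + 1, S, T, U, _, _, _, hf0, hf1, hfm, hg0, hg1, hgm, hh0, hh1, hhm, htc, b => by
    obtain ⟨f0, f1, fm⟩ := andAdjoin_props m (Fin.tail S) hf0 hf1 hfm
    obtain ⟨g0, g1, gm⟩ := andAdjoin_props m (Fin.tail T) hg0 hg1 hgm
    obtain ⟨h0', h1', hm'⟩ := andAdjoin_props m (Fin.tail U) hh0 hh1 hhm
    have IH := tc_andAdjoin_nonneg m (Fin.tail S) (Fin.tail T) (Fin.tail U) hf0 hf1 hfm hg0 hg1 hgm hh0 hh1 hhm htc (Fin.tail b)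
    have hb : b = Fin.cons (b 0) (Fin.tail b) := (Fin.cons_self_tail b).symm
    rw [hb]
    exact tc_andAdj_cons_nonneg (b 0) (Fin.tail b) (S 0) (T 0) (U 0) f0 fm g0 gm h0' hm' IH

/-! ### §6 New settled classes of 3C-SAHI -/

/-- Indicators of finite sets of points take values in `[0,1]`. [this work] -/
theorem setInd_le_one' (A : Finset (Pt d)) (x : Pt d) : setInd A x ≤ 1 := by
  unfold setInd; split_ifs <;> norm_num

/-- ★ **(principal up-set ∨ OR-event, up-set ∨ OR-event, up-set ∨ OR-event)**: for a principal up-set `↑mₚ` and ARBITRARY up-sets `B, C` of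
`{0,1}^d` and any `S, T, U ⊆ [m]`: `0 ≤ c_b(1_{↑mₚ} ∨ OR_S, 1_B ∨ OR_T, 1_C ∨ OR_U)` at every profile of `{0,1}^{d+m}` (one-cylinder-slot theorem
`tc_setInd_principal_nonneg` of `…Cylinder` + OR-stability). [this work] -/
theorem tc_orAdjoin_principal_nonneg (m : ℕ) (S T U : Fin m → Bool) (mₚ : Pt d) {B C : Finset (Pt d)}
    (hB : IsUpperSet (B : Set (Pt d))) (hC : IsUpperSet (C : Set (Pt d))) (b : Fin (d + m) → ℕ) :
    0 ≤ tc b (orAdjoin m S (setInd (univ.filter fun x : Pt d => ∀ i, mₚ i = true → x i = true)))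
      (orAdjoin m T (setInd B)) (orAdjoin m U (setInd C)) := by
  have hA : IsUpperSet ((univ.filter fun x : Pt d => ∀ i, mₚ i = true → x i = true : Finset (Pt d)) : Set (Pt d)) := by
    intro x y hxy hx
    simp only [coe_filter, mem_univ, true_and, Set.mem_setOf_eq] at hx ⊢
    exact fun i hi => Bool.eq_true_of_true_le ((hx i hi) ▸ hxy i)
  exact tc_orAdjoin_nonneg m S T U (setInd_nonneg _) (setInd_le_one' _) (monotone_setInd hA) (setInd_nonneg _) (setInd_le_one' _)
    (monotone_setInd hB) (setInd_nonneg _) (setInd_le_one' _) (monotone_setInd hC)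
    (fun b' => tc_setInd_principal_nonneg b' mₚ hB hC) b

/-- ★ **(up-set ∨ OR-event)³ with two nested inner events**: for up-sets `A, B ⊆ C`: `0 ≤ c_b(1_A ∨ OR_S, 1_B ∨ OR_T, 1_C ∨ OR_U)`. [this work] -/
theorem tc_orAdjoin_nested_nonneg (m : ℕ) (S T U : Fin m → Bool) {A B C : Finset (Pt d)} (hA : IsUpperSet (A : Set (Pt d)))
    (hB : IsUpperSet (B : Set (Pt d))) (hC : IsUpperSet (C : Set (Pt d))) (hBC : B ⊆ C) (b : Fin (d + m) → ℕ) :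
    0 ≤ tc b (orAdjoin m S (setInd A)) (orAdjoin m T (setInd B)) (orAdjoin m U (setInd C)) :=
  tc_orAdjoin_nonneg m S T U (setInd_nonneg _) (setInd_le_one' _) (monotone_setInd hA) (setInd_nonneg _) (setInd_le_one' _)
    (monotone_setInd hB) (setInd_nonneg _) (setInd_le_one' _) (monotone_setInd hC)
    (fun b' => tc_setInd_nonneg_of_subset₂₃ b' hA hB hC hBC) b

/-- ★ **(OR-event ∧ cylinder)³**: `0 ≤ c_b(1_{A_S} · Π_{S'} x, 1_{A_T} · Π_{T'} x, 1_{A_U} · Π_{U'} x)` — OR-events on `{0,1}^d` each AND-ed with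
cylinders on `m` fresh coordinates (`…OrEvents.tc_orInd_nonneg` + AND-stability). [this work] -/
theorem tc_andAdjoin_orInd_nonneg (m : ℕ) (S' T' U' : Fin m → Bool) (S T U : Finset (Fin d)) (b : Fin (d + m) → ℕ) :
    0 ≤ tc b (andAdjoin m S' (orInd S)) (andAdjoin m T' (orInd T)) (andAdjoin m U' (orInd U)) := by
  have h1 : ∀ (X : Finset (Fin d)) (x : Pt d), orInd X x ≤ 1 := fun X x => by unfold orInd; split_ifs <;> norm_num
  exact tc_andAdjoin_nonneg m S' T' U' (orInd_nonneg S) (h1 S) (monotone_orInd S) (orInd_nonneg T) (h1 T) (monotone_orInd T)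
    (orInd_nonneg U) (h1 U) (monotone_orInd U) (fun b' => tc_orInd_nonneg b' S T U) b

/-- Law level (every coin weight `q ∈ [0,1]^{d+m}`): `0 ≤ E₃^{coin q}(1_{↑mₚ} ∨ OR_S, 1_B ∨ OR_T, 1_C ∨ OR_U)`. [this work] -/
theorem sahiE_three_coin_orAdjoin_principal_nonneg (m : ℕ) (S T U : Fin m → Bool) (mₚ : Pt d) {B C : Finset (Pt d)}
    (hB : IsUpperSet (B : Set (Pt d))) (hC : IsUpperSet (C : Set (Pt d))) {q : Fin (d + m) → ℝ} (hq : ∀ i, 0 ≤ q i ∧ q i ≤ 1) :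
    0 ≤ sahiE (coinWeight q) 3 ![orAdjoin m S (setInd (univ.filter fun x : Pt d => ∀ i, mₚ i = true → x i = true)),
      orAdjoin m T (setInd B), orAdjoin m U (setInd C)] :=
  sahiE_three_coin_nonneg_of_tc hq fun b => tc_orAdjoin_principal_nonneg m S T U mₚ hB hC b

end

end Summit.CriticalPhenomena.PercolationContinuityZ3.Theorems.SahiThreeCopy
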